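import Summits.QuantumFields.YangMills.Theorems.BalabanUVNodesN12FlatDatumRigidityNested
import Summits.QuantumFields.YangMills.Theorems.BalabanUVNodesN12TowerSiteGraphConnectedNestedLam
import HarnessLib

/-!
# BalabanUVNodes ∕ N12 — RIGIDITY AT THE FLAT DATUM ON PRINT's BONDS `lamBondsSeq Ω k` ([II] (2.3): `Λ_j` as the DIFFERENCE of the bond sets): a holonomy-flat configuration with trivial
# straight transporters on PRINT's constrained bonds is `1^{u}` with `u = 1` at both tower sites of every print bond — the print-datum twin of the lane's `…N12FlatDatumRigidityNested(Prelim)`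

[Balaban1984PropagatorsII] = «[II]», (2.3) p. 224 (*«Λ_j = Ω_j^{(j)} ∖ Ω_{j+1}^{(j)} … for the sets of sites and the sets of bonds»*; ruling (α): the DIFFERENCE of the bond sets — inward
connectors dropped, outward connectors kept); [Balaban1985Variational] = «[15]», Thm 1 p. 279 («a unique critical orbit»), (3)–(4), (7) p. 278; [Balaban1988Convergent] = «[III]»,
(2.1)–(2.2) pp. 254–255, (2.10)–(2.13) pp. 256–257; [Balaban1985RegularSpaces] (1.3)–(1.6) p. 77, (1.14) p. 78; [Balaban1987RG1] (0.1)–(0.3) pp. 251–252; [Balaban1985Averaging] (8), (11)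
pp. 18–19; [Balaban1984PropagatorsI] (1.7) p. 18.

Cell `pub-ymgap` (HUMAN RULINGS D-0062 ∕ D-0149), WIDTH SEAT `pub-ymgap-dag-n12-w6` g24 (node N12 = [B15]; key K1⁹ `stmt-QuantumFields-27364`, `--kind proof --supports … --as helper`;
count-neutral).  THEOREMS ONLY (0 `def`, 0 `instance`, 0 `sorry`).  GREEN imports only: the lane's (dag-n12-c g30) `…N12FlatDatumRigidityNested` (✓; closure = `…NestedPrelim` + this
seat's g17 `…FlatDatumRigidity(Prelim)`) and this seat's g24 `…TowerSiteGraphConnectedNestedLam` (✓; §0 «not deep» lemmas, F0a `B15DeterminingSetsB.lamBondsSeq`); nothing of the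
`Node00/Record13*` cone.  Consumed BY NAME: g17's comb gauge ∕ word calculus (`walkEnd_treeWord_liftSub`, `natAbs_netDisp_treeWord_liftSub_le`, `holAt_walk_segments_eq_one`,
`walkEnd_segments`, `natAbs_netDisp_segments_le`, `segments_budget_le`, `holAt_comb_eq_one_of_eq`, `holAt_gaugeAct_one_walk`), the lane's level lemmas (`exists_level_genSet`,
`level_unique_genSet`, `levels_near_of_shift_genSet`, `mem_of_level`, `not_mem_succ_of_level`, `mem_genSet_of_blockOf_eq_outerBlock`), dag-n12-w3's `exists_blockWalk_centre`.

WHY.  The (E∕U) name at PRINT's datum (dag-n12-c g34 ✓p767125 `B11Thm1ExistsUniqueTokensGB.VariationalThm1EUSepTop7MGB … (lamDatum F) …`) carries [15] Thm 1's tower-central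
uniqueness clause over print's bonds; its A2 witness at the flat datum `W := M˙(1)` (the lane's, pre-staged; (b)-datum edition ✓p744645 :135) consumes a RIGIDITY theorem: two
holonomy-flat configurations whose straight transporters along the CONSTRAINED bonds are trivial differ by a gauge transformation central (= 1) at the tower sites.  At print's datum
the minimiser's constraint yields trivial transporters ONLY on `lamBondsSeq Ω k j ⊆ bondsOf (genSet Ω k j)` (no inward connectors), a WEAKER hypothesis than the lane's (a)
`exists_gauge_eq_one_on_towers_of_flat_segments_genSet` takes — so the rigidity is re-run here on print's bonds, exactly as the graph connectivity was (this seat's ✓p767987).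

THE PROOF (g17's comb gauge, the lane's (a′) §2 chain words re-run on print's bonds).  §1: the local chain word between the tower projections of adjacent fine sites uses ONLY print
bonds — at equal levels the segment of `⟨B^j(x), μ⟩` with BOTH ends in `Γ_j^{(j)}` (both `(j+1)`-blocks off `Ω_{j+1}`, (B)); across levels `j`, `j+1` the in-block walk inside the outer
block `w = B^{j+1}(·) ⊄ Ω_{j+1}` (intra-block level-`j` bonds: both end blocks `= w`, not deep) followed ∕ preceded by the segment of the OUTWARD CONNECTOR `⟨B^{j+1}(x), μ⟩` (source ∕
target block off `Ω_{j+2} ⊆ Ω_{j+1}` by (N), the `Γ_{j+1}`-end off `Ω_{j+2}` by (B); nothing excluded at `j + 1 = k`).  §2: (a)'s proof verbatim with the chain word of §1 — comb gauge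
`u(x) = U(comb τx → x)⁻¹`, the local closed word has zero net displacement under the letter budget `(d+3)Lᵏ ≤ |T_η|`, holonomy-flatness gives `U = 1^{u}`, `u = 1` at the `Γ`-ends
(empty comb) and at the other ends of PRINT bonds by (8) telescoped along their trivial segments.

CONTENTS (namespace `Summit.QuantumFields.YangMills.BalabanUVNodes.N12FlatDatumRigidityNestedLam`; generic `P : Params`, generic `GaugeGroup G`): §1 ★★ `exists_chainWord_same_lam` ∕
`exists_chainWord_up_lam` ∕ `exists_chainWord_down_lam` ∕ `exists_chainWord_of_shift_lam`; §2 ★★★ `exists_gauge_eq_one_on_towers_of_flat_segments_lamBondsSeq`, ★★★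
`exists_towerCentral_gauge_of_flat_segments_lamBondsSeq` (the uniqueness clause of ✓p767125 read at two flat configurations).

HONEST FRAMING.  A generic rigidity statement for flat fibre configurations at print's datum under (N)(B)(S) — NOT [15] Thm 1 at general data, NOT an (E∕U) producer, NOT the A2
witness itself; nothing of Bałaban's estimates asserted or refuted; count-neutral helper; N12 NOT discharged; K0⁷∕K1⁹ NOT closed; counts of record unmoved; one finite 𝕋⁴ programme at
fixed ε — R4 closes the conditional rung `BalabanLadder.UV` only; the Yang–Mills mass gap (Clay) is NOT proved by any of this; nothing continuum ∕ ℝ⁴ ∕ OS.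
-/

namespace Summit.QuantumFields.YangMills.BalabanUVNodes.N12FlatDatumRigidityNestedLam

open Set
open Literature.MathematicalPhysics.QuantumFieldTheory.Balaban1983to89
open B15DeterminingSets (DetSet pts mem_pts bondsOf embIter genSet)
open B15DeterminingSetsB (lamBondsSeq)
open B14.Eq22Determines (blockIter blockIter_zero blockIter_succ IsBlockUnion)
open B15Eq112TorusCover (cover lift cover_lift)
open T4Continuum (walk walkEnd holAt netDisp Letter LStep wordRev walk_append walkEnd_append holAt_append holAt_walk_wordRev wordRev_replicate
  netDisp_wordRev holAt_nil holAt_cons netDisp_cons walkEnd_apply walkEnd_walkEnd_wordRev holAt_gaugeAct_walk)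
open T4ReflectionCone (netDisp_append netDisp_replicate)
open B7Prop1Explicit (treeWord treeWord_zero)
open B16Sect1Backgrounds (toMS mulG gaugeAct_gaugeAct)
open Summit.QuantumFields.YangMills.Theorems.Prop7FlatHolonomy (holAt_walk_append holAt_walk_single_true)
open Summit.QuantumFields.YangMills.BalabanUVNodes.N12BlockChains (blockOf_shift_or exists_blockWalk_centre embIter_shift_eq_walkEnd)
open Summit.QuantumFields.YangMills.Theorems.N21ReadSetSupport (blockIter_embIter)
open Summit.QuantumFields.YangMills.BalabanUVNodes.N12TowerSiteGraphConnectedBjPrelim (blockIter_shift_or)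
open Summit.QuantumFields.YangMills.BalabanUVNodes.N12FlatDatumRigidityPrelim (natAbs_netDisp_le_length netDisp_eq_zero_of_walkEnd_eq walkEnd_treeWord_liftSub
  natAbs_netDisp_treeWord_liftSub_le holAt_walk_segments_eq_one walkEnd_segments natAbs_netDisp_segments_le segments_budget_le)
open Summit.QuantumFields.YangMills.BalabanUVNodes.N12FlatDatumRigidity (holAt_gaugeAct_one_walk holAt_comb_eq_one_of_eq)
open Summit.QuantumFields.YangMills.BalabanUVNodes.N12FlatDatumRigidityNestedPrelim (exists_level_genSet level_unique_genSet levels_near_of_shift_genSet mem_of_level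
  not_mem_succ_of_level mem_genSet_of_blockOf_eq_outerBlock)
open Summit.QuantumFields.YangMills.BalabanUVNodes.N12TowerSiteGraphConnectedNestedLam (blockOf_not_mem_pts_succ mem_lamBondsSeq_of_not_deep
  src_or_tgt_mem_genSet_of_mem_lamBondsSeq)

variable {P : Params} {k : ℕ} {Ω : ℕ → Set (Site P 0)}

section Words

variable {G : Type*} [GaugeGroup G]

/-! ## §1  The local chain words between the tower projections of adjacent fine sites run along PRINT bonds only -/

/-- ★★ **SAME LEVEL** (`x` and `x + e_μ` both of level `j ≤ k`): the empty word or the straight segment of the print bond `⟨B^j(x), μ⟩` — both ends in `Γ_j^{(j)}`, hence (for `j < k`) both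
`(j+1)`-blocks off `Ω_{j+1}` ((B)); with only one end of level `j` the bond could be an inward connector, whence both level hypotheses.
[cite: Balaban1984PropagatorsII, (2.3) p.224; Balaban1988Convergent, (2.2) p.255, (2.10)–(2.12) p.256; Balaban1984PropagatorsI, (1.7) p.18] -/
theorem exists_chainWord_same_lam (hk : k ≤ P.m + P.K) (hBU : ∀ j, 1 ≤ j → j ≤ k → IsBlockUnion j (Ω j)) {U : GaugeField P 0 G}
    (hseg : ∀ j, j ≤ k → ∀ c ∈ lamBondsSeq Ω k j, holAt U (walk (embIter j c.src) (List.replicate (P.L ^ j) (c.dir, true))) = 1)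
    {x : Site P 0} {μ : Fin P.d} {j : ℕ} (hj : j ≤ k) (h : blockIter j x ∈ genSet Ω k j) (h' : blockIter j (x.shift μ) ∈ genSet Ω k j) :
    ∃ ω : List (Letter P.d), walkEnd (embIter j (blockIter j x)) ω = embIter j (blockIter j (x.shift μ)) ∧
      holAt U (walk (embIter j (blockIter j x)) ω) = 1 ∧ ∀ ν, (netDisp ω ν).natAbs ≤ (P.d + 1) * P.L ^ k := by
  rcases blockIter_shift_or (hj.trans hk) x μ with e | e
  · exact ⟨[], by rw [e]; rfl, by simp [walk, holAt_nil], fun ν => by simp [netDisp]⟩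
  · have hb : P.L ^ j ≤ (P.d + 1) * P.L ^ k :=
      le_trans (Nat.pow_le_pow_right P.L_pos hj) (Nat.le_mul_of_pos_left _ (Nat.succ_pos _))
    have hc : (⟨blockIter j x, μ⟩ : PBond P j) ∈ lamBondsSeq Ω k j := by
      refine mem_lamBondsSeq_of_not_deep (Or.inl h) (fun hjk => ?_) (fun hjk => ?_)
      · exact blockOf_not_mem_pts_succ hBU (by omega) (not_mem_succ_of_level hk hBU hjk h) (blockIter_succ j x).symm
      · have e' : blockOf ((⟨blockIter j x, μ⟩ : PBond P j).tgt) = blockIter (j + 1) (x.shift μ) := by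
          show blockOf ((blockIter j x).shift μ) = _
          rw [← e, blockIter_succ]
        exact blockOf_not_mem_pts_succ hBU (by omega) (not_mem_succ_of_level hk hBU hjk h') e'
    refine ⟨List.replicate (P.L ^ j) (μ, true), ?_, hseg j hj ⟨blockIter j x, μ⟩ hc, fun ν => ?_⟩
    · rw [e]; exact (embIter_shift_eq_walkEnd j _ μ).symm
    · rw [netDisp_replicate]
      split_ifs <;> simp [hb]

/-- ★★ **ONE LEVEL UP** under (N)(B)(S) (`x` of level `j`, `x + e_μ` of level `j + 1 ≤ k`): the in-block walk from `B^j(x)` to the centre of the outer block `w = B^{j+1}(x) ⊄ Ω_{j+1}` (intra-block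
level-`j` print bonds: `Γ_j`-sites by `mem_genSet_of_blockOf_eq_outerBlock`, both end blocks `= w` not deep) followed by the straight segment of the OUTWARD CONNECTOR `⟨w, μ⟩` (a print
bond: source block `B^{j+2}(x)` off `Ω_{j+2} ⊆ Ω_{j+1}` by (N), target a `Γ_{j+1}`-block off `Ω_{j+2}` by (B); nothing excluded at `j + 1 = k`).
[cite: Balaban1984PropagatorsII, (2.3) p.224; Balaban1988Convergent, (2.2) p.255, (2.13) pp.256–257; Balaban1984PropagatorsI, (1.7) p.18] -/
theorem exists_chainWord_up_lam (hk1 : 1 ≤ k) (hk : k ≤ P.m + P.K) (hnest : ∀ j, 1 ≤ j → j < k → Ω (j + 1) ⊆ Ω j)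
    (hBU : ∀ j, 1 ≤ j → j ≤ k → IsBlockUnion j (Ω j))
    (hsep : ∀ j, 1 ≤ j → j + 1 ≤ k → ∀ (x z : Site P 0) (μ : Fin P.d), (z = x.shift μ ∨ x = z.shift μ) → z ∈ Ω (j + 1) →
      ∀ y : Site P 0, blockIter (j + 1) y = blockIter (j + 1) x → y ∈ Ω j)
    {U : GaugeField P 0 G}
    (hseg : ∀ j, j ≤ k → ∀ c ∈ lamBondsSeq Ω k j, holAt U (walk (embIter j c.src) (List.replicate (P.L ^ j) (c.dir, true))) = 1)
    {x : Site P 0} {μ : Fin P.d} {j : ℕ} (hj : j + 1 ≤ k)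
    (h : blockIter j x ∈ genSet Ω k j) (h' : blockIter (j + 1) (x.shift μ) ∈ genSet Ω k (j + 1)) :
    ∃ ω : List (Letter P.d), walkEnd (embIter j (blockIter j x)) ω = embIter (j + 1) (blockIter (j + 1) (x.shift μ)) ∧
      holAt U (walk (embIter j (blockIter j x)) ω) = 1 ∧ ∀ ν, (netDisp ω ν).natAbs ≤ (P.d + 1) * P.L ^ k := by
  have hx : x ∉ Ω (j + 1) := not_mem_succ_of_level hk hBU (by omega) h
  have hx' : x.shift μ ∈ Ω (j + 1) := mem_of_level hBU (by omega) hj h'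
  have hBU1 := hBU (j + 1) (by omega) hj
  rcases blockIter_shift_or (show j + 1 ≤ P.m + P.K by omega) x μ with e | e
  · exfalso
    have h1 := (hBU1 (x.shift μ)).1 hx'
    rw [e] at h1
    exact hx ((hBU1 x).2 h1)
  · obtain ⟨ch, hlen, hmem, hend, hcons⟩ := exists_blockWalk_centre (show j + 1 ≤ P.m + P.K by omega) (blockIter j x) (emb (blockIter (j + 1) x))
      (blockIter (j + 1) x) (blockIter_succ j x).symm (Site.blockOf_emb (by omega) _) (Or.inr rfl)
    -- every link of the in-block walk is an intra-block print bond
    have hchseg : ∀ l ∈ ch, holAt U (walk (embIter j l.1.src) (List.replicate (P.L ^ j) (l.1.dir, true))) = 1 := fun l hl =>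
      hseg j (by omega) l.1 (mem_lamBondsSeq_of_not_deep
        (Or.inl (mem_genSet_of_blockOf_eq_outerBlock hk1 hk hBU hsep hj (Or.inl rfl) hx' hx (hmem l hl).1))
        (fun _ => blockOf_not_mem_pts_succ hBU hj hx (hmem l hl).1) (fun _ => blockOf_not_mem_pts_succ hBU hj hx (hmem l hl).2))
    have e1 : walkEnd (embIter j (blockIter j x)) ((ch.map fun l => List.replicate (P.L ^ j) (l.1.dir, l.2)).flatten) = embIter (j + 1) (blockIter (j + 1) x) := by
      rw [walkEnd_segments, hend]; rfl
    -- the outward connector `⟨w, μ⟩` is a print bond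
    have hc : (⟨blockIter (j + 1) x, μ⟩ : PBond P (j + 1)) ∈ lamBondsSeq Ω k (j + 1) := by
      refine mem_lamBondsSeq_of_not_deep (Or.inr ?_) (fun hjk => ?_) (fun hjk => ?_)
      · show (blockIter (j + 1) x).shift μ ∈ genSet Ω k (j + 1)
        rw [← e]; exact h'
      · have hx2 : x ∉ Ω (j + 1 + 1) := fun hm => hx (hnest (j + 1) (by omega) hjk hm)
        exact blockOf_not_mem_pts_succ hBU (by omega) hx2 (blockIter_succ (j + 1) x).symm
      · have hx2 : x.shift μ ∉ Ω (j + 1 + 1) := not_mem_succ_of_level hk hBU hjk h'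
        have e' : blockOf ((⟨blockIter (j + 1) x, μ⟩ : PBond P (j + 1)).tgt) = blockIter (j + 1 + 1) (x.shift μ) := by
          show blockOf ((blockIter (j + 1) x).shift μ) = _
          rw [← e]
          exact (blockIter_succ (j + 1) (x.shift μ)).symm
        exact blockOf_not_mem_pts_succ hBU (by omega) hx2 e'
    refine ⟨(ch.map fun l => List.replicate (P.L ^ j) (l.1.dir, l.2)).flatten ++ List.replicate (P.L ^ (j + 1)) (μ, true), ?_, ?_, fun ν => ?_⟩
    · rw [walkEnd_append, e1, e]
      exact (embIter_shift_eq_walkEnd (j + 1) _ μ).symm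
    · have hs := hseg (j + 1) hj _ hc
      rw [holAt_walk_append, holAt_walk_segments_eq_one U ch _ hchseg hcons, one_mul, e1]
      exact hs
    · rw [netDisp_append]
      have h1 := natAbs_netDisp_segments_le ch ν (i := j)
      have h2 : (netDisp (List.replicate (P.L ^ (j + 1)) ((μ, true) : Letter P.d)) ν).natAbs ≤ P.L ^ (j + 1) := by
        rw [netDisp_replicate]; split_ifs <;> simp
      calc _ ≤ _ + _ := Int.natAbs_add_le _ _
        _ ≤ P.L ^ j * ch.length + P.L ^ (j + 1) := add_le_add h1 h2
        _ ≤ (P.d + 1) * P.L ^ k := segments_budget_le hj hlen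

/-- ★★ **ONE LEVEL DOWN** under (N)(B)(S) (`x` of level `j + 1 ≤ k`, `x + e_μ` of level `j`): the straight segment of the OUTWARD CONNECTOR `⟨B^{j+1}(x), μ⟩` (sourced in `Γ_{j+1}` — off
`Ω_{j+2}` by (B); target the outer block `B^{j+1}(x + e_μ)`, off `Ω_{j+2} ⊆ Ω_{j+1}` by (N)) followed by the in-block walk to `B^j(x + e_μ)` (intra-block print bonds).
[cite: Balaban1984PropagatorsII, (2.3) p.224; Balaban1988Convergent, (2.2) p.255, (2.13) pp.256–257; Balaban1984PropagatorsI, (1.7) p.18] -/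
theorem exists_chainWord_down_lam (hk1 : 1 ≤ k) (hk : k ≤ P.m + P.K) (hnest : ∀ j, 1 ≤ j → j < k → Ω (j + 1) ⊆ Ω j)
    (hBU : ∀ j, 1 ≤ j → j ≤ k → IsBlockUnion j (Ω j))
    (hsep : ∀ j, 1 ≤ j → j + 1 ≤ k → ∀ (x z : Site P 0) (μ : Fin P.d), (z = x.shift μ ∨ x = z.shift μ) → z ∈ Ω (j + 1) →
      ∀ y : Site P 0, blockIter (j + 1) y = blockIter (j + 1) x → y ∈ Ω j)
    {U : GaugeField P 0 G}
    (hseg : ∀ j, j ≤ k → ∀ c ∈ lamBondsSeq Ω k j, holAt U (walk (embIter j c.src) (List.replicate (P.L ^ j) (c.dir, true))) = 1)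
    {x : Site P 0} {μ : Fin P.d} {j : ℕ} (hj : j + 1 ≤ k)
    (h : blockIter (j + 1) x ∈ genSet Ω k (j + 1)) (h' : blockIter j (x.shift μ) ∈ genSet Ω k j) :
    ∃ ω : List (Letter P.d), walkEnd (embIter (j + 1) (blockIter (j + 1) x)) ω = embIter j (blockIter j (x.shift μ)) ∧
      holAt U (walk (embIter (j + 1) (blockIter (j + 1) x)) ω) = 1 ∧ ∀ ν, (netDisp ω ν).natAbs ≤ (P.d + 1) * P.L ^ k := by
  have hx : x ∈ Ω (j + 1) := mem_of_level hBU (by omega) hj h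
  have hx' : x.shift μ ∉ Ω (j + 1) := not_mem_succ_of_level hk hBU (by omega) h'
  have hBU1 := hBU (j + 1) (by omega) hj
  rcases blockIter_shift_or (show j + 1 ≤ P.m + P.K by omega) x μ with e | e
  · exfalso
    have h1 := (hBU1 x).1 hx
    rw [← e] at h1
    exact hx' ((hBU1 (x.shift μ)).2 h1)
  · obtain ⟨ch, hlen, hmem, hend, hcons⟩ := exists_blockWalk_centre (show j + 1 ≤ P.m + P.K by omega) (emb (blockIter (j + 1) (x.shift μ)))
      (blockIter j (x.shift μ)) (blockIter (j + 1) (x.shift μ)) (Site.blockOf_emb (by omega) _) (blockIter_succ j (x.shift μ)).symm (Or.inl rfl)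
    -- every link of the in-block walk is an intra-block print bond (the block `B^{j+1}(x + e_μ)` is off `Ω_{j+1}`)
    have hchseg : ∀ l ∈ ch, holAt U (walk (embIter j l.1.src) (List.replicate (P.L ^ j) (l.1.dir, true))) = 1 := fun l hl =>
      hseg j (by omega) l.1 (mem_lamBondsSeq_of_not_deep
        (Or.inl (mem_genSet_of_blockOf_eq_outerBlock hk1 hk hBU hsep hj (Or.inr rfl) hx hx' (hmem l hl).1))
        (fun _ => blockOf_not_mem_pts_succ hBU hj hx' (hmem l hl).1) (fun _ => blockOf_not_mem_pts_succ hBU hj hx' (hmem l hl).2))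
    -- the outward connector `⟨B^{j+1}(x), μ⟩` is a print bond
    have hc : (⟨blockIter (j + 1) x, μ⟩ : PBond P (j + 1)) ∈ lamBondsSeq Ω k (j + 1) := by
      refine mem_lamBondsSeq_of_not_deep (Or.inl h) (fun hjk => ?_) (fun hjk => ?_)
      · have hx2 : x ∉ Ω (j + 1 + 1) := not_mem_succ_of_level hk hBU hjk h
        exact blockOf_not_mem_pts_succ hBU (by omega) hx2 (blockIter_succ (j + 1) x).symm
      · have hx2 : x.shift μ ∉ Ω (j + 1 + 1) := fun hm => hx' (hnest (j + 1) (by omega) hjk hm)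
        have e' : blockOf ((⟨blockIter (j + 1) x, μ⟩ : PBond P (j + 1)).tgt) = blockIter (j + 1 + 1) (x.shift μ) := by
          show blockOf ((blockIter (j + 1) x).shift μ) = _
          rw [← e]
          exact (blockIter_succ (j + 1) (x.shift μ)).symm
        exact blockOf_not_mem_pts_succ hBU (by omega) hx2 e'
    have e1 : walkEnd (embIter (j + 1) (blockIter (j + 1) x)) (List.replicate (P.L ^ (j + 1)) (μ, true)) = embIter j (emb (blockIter (j + 1) (x.shift μ))) := by
      rw [← embIter_shift_eq_walkEnd, ← e]; rfl
    refine ⟨List.replicate (P.L ^ (j + 1)) (μ, true) ++ (ch.map fun l => List.replicate (P.L ^ j) (l.1.dir, l.2)).flatten, ?_, ?_, fun ν => ?_⟩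
    · rw [walkEnd_append, e1, walkEnd_segments, hend]
    · rw [holAt_walk_append, hseg (j + 1) hj _ hc, one_mul, e1]
      exact holAt_walk_segments_eq_one U ch _ hchseg hcons
    · rw [netDisp_append]
      have h1 := natAbs_netDisp_segments_le ch ν (i := j)
      have h2 : (netDisp (List.replicate (P.L ^ (j + 1)) ((μ, true) : Letter P.d)) ν).natAbs ≤ P.L ^ (j + 1) := by
        rw [netDisp_replicate]; split_ifs <;> simp
      calc _ ≤ _ + _ := Int.natAbs_add_le _ _
        _ ≤ P.L ^ (j + 1) + P.L ^ j * ch.length := add_le_add h2 h1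
        _ = P.L ^ j * ch.length + P.L ^ (j + 1) := add_comm _ _
        _ ≤ (P.d + 1) * P.L ^ k := segments_budget_le hj hlen

/-- ★★ **THE LOCAL CHAIN WORD OF A FINE BOND RUNS ALONG PRINT BONDS** under (N)(B)(S): between the tower projections of `x` (level `j`) and `x + e_μ` (level `j'`) there is a word of net
displacement `≤ (d+1)Lᵏ` per direction with trivial holonomy, for every `U` whose straight transporters along the bonds of `lamBondsSeq Ω k` are trivial (levels at most one apart; then
`_same_lam` ∕ `_up_lam` ∕ `_down_lam`). [cite: Balaban1984PropagatorsII, (2.3) p.224; Balaban1988Convergent, (2.2) p.255, (2.13) pp.256–257; Balaban1984PropagatorsI, (1.7) p.18] -/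
theorem exists_chainWord_of_shift_lam (hk1 : 1 ≤ k) (hk : k ≤ P.m + P.K) (hnest : ∀ j, 1 ≤ j → j < k → Ω (j + 1) ⊆ Ω j)
    (hBU : ∀ j, 1 ≤ j → j ≤ k → IsBlockUnion j (Ω j))
    (hsep : ∀ j, 1 ≤ j → j + 1 ≤ k → ∀ (x z : Site P 0) (μ : Fin P.d), (z = x.shift μ ∨ x = z.shift μ) → z ∈ Ω (j + 1) →
      ∀ y : Site P 0, blockIter (j + 1) y = blockIter (j + 1) x → y ∈ Ω j)
    {U : GaugeField P 0 G}
    (hseg : ∀ j, j ≤ k → ∀ c ∈ lamBondsSeq Ω k j, holAt U (walk (embIter j c.src) (List.replicate (P.L ^ j) (c.dir, true))) = 1)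
    (x : Site P 0) (μ : Fin P.d) {j j' : ℕ} (hj : j ≤ k) (hj' : j' ≤ k)
    (h : blockIter j x ∈ genSet Ω k j) (h' : blockIter j' (x.shift μ) ∈ genSet Ω k j') :
    ∃ ω : List (Letter P.d), walkEnd (embIter j (blockIter j x)) ω = embIter j' (blockIter j' (x.shift μ)) ∧
      holAt U (walk (embIter j (blockIter j x)) ω) = 1 ∧ ∀ ν, (netDisp ω ν).natAbs ≤ (P.d + 1) * P.L ^ k := by
  obtain ⟨h1, h2⟩ := levels_near_of_shift_genSet hk hnest hBU hsep hj hj' h h'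
  rcases lt_trichotomy j j' with hlt | rfl | hgt
  · obtain rfl : j' = j + 1 := by omega
    exact exists_chainWord_up_lam hk1 hk hnest hBU hsep hseg hj' h h'
  · exact exists_chainWord_same_lam hk hBU hseg hj h h'
  · obtain rfl : j = j' + 1 := by omega
    exact exists_chainWord_down_lam hk1 hk hnest hBU hsep hseg hj h h'

end Words

/-! ## §2  Rigidity at the flat datum on print's bonds -/

section Rigidity

variable {G : Type*} [GaugeGroup G]

/-- ★★★ **RIGIDITY AT THE FLAT DATUM ON PRINT's BONDS.**  Under (N)(B)(S), `1 ≤ k ≤ m + K` and the letter budget `(d+3)Lᵏ ≤ |T_η|`: a HOLONOMY-FLAT configuration `U` whose straight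
transporters along the bonds of PRINT's datum `lamBondsSeq Ω k` are trivial is `1^{u}` for a gauge transformation `u` with `u(ι_j c₋) = u(ι_j c₊) = 1` at both tower sites of every print
bond — print's group (4) read on [II] (2.3)'s `Λ_j`.  Proof: the lane's (a) proof verbatim (g17's comb gauge `u(x) = U(comb τx → x)⁻¹`, local closed word of zero net displacement,
holonomy-flatness, (8) along the trivial segments) with the chain word of §1.
[cite: Balaban1984PropagatorsII, (2.3) p.224; Balaban1985Variational, Thm 1 p.279, (3)–(4) p.278; Balaban1988Convergent, (2.2) p.255, (2.10)–(2.13) pp.256–257; Balaban1985Averaging, (8), (11) pp.18–19] -/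
theorem exists_gauge_eq_one_on_towers_of_flat_segments_lamBondsSeq (hk1 : 1 ≤ k) (hk : k ≤ P.m + P.K)
    (hnest : ∀ j, 1 ≤ j → j < k → Ω (j + 1) ⊆ Ω j) (hBU : ∀ j, 1 ≤ j → j ≤ k → IsBlockUnion j (Ω j))
    (hsep : ∀ j, 1 ≤ j → j + 1 ≤ k → ∀ (x z : Site P 0) (μ : Fin P.d), (z = x.shift μ ∨ x = z.shift μ) → z ∈ Ω (j + 1) →
      ∀ y : Site P 0, blockIter (j + 1) y = blockIter (j + 1) x → y ∈ Ω j)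
    (hfit : (P.d + 3) * P.L ^ k ≤ P.sitesPerDir 0)
    (U : GaugeField P 0 G) (hflat : ∀ (x : Site P 0) (w : List (Letter P.d)), (∀ ν, netDisp w ν = 0) → holAt U (walk x w) = 1)
    (hseg : ∀ j, j ≤ k → ∀ c ∈ lamBondsSeq Ω k j, holAt U (walk (embIter j c.src) (List.replicate (P.L ^ j) (c.dir, true))) = 1) :
    ∃ u : GaugeTransf P 0 G, (∀ j, j ≤ k → ∀ c ∈ lamBondsSeq Ω k j, u (embIter j c.src) = 1 ∧ u (embIter j c.tgt) = 1) ∧ GaugeField.gaugeAct u 1 = U := by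
  choose lv hlv using fun x : Site P 0 => exists_level_genSet (Ω := Ω) hk1 hk hBU x
  obtain ⟨τ, hτ⟩ : ∃ τ : Site P 0 → Site P 0, ∀ x, τ x = embIter (lv x) (blockIter (lv x) x) := ⟨_, fun _ => rfl⟩
  obtain ⟨cw, hcw⟩ : ∃ cw : Site P 0 → List (Letter P.d), ∀ x, cw x = treeWord (fun ν => lift P x ν - lift P (τ x) ν) := ⟨_, fun _ => rfl⟩
  have hcw_end : ∀ x, walkEnd (τ x) (cw x) = x := fun x => by rw [hcw]; exact walkEnd_treeWord_liftSub (τ x) x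
  have hcw_nd : ∀ x ν, (netDisp (cw x) ν).natAbs ≤ P.L ^ k - 1 := fun x ν => by
    rw [hcw, hτ]
    have h := natAbs_netDisp_treeWord_liftSub_le ((hlv x).1.trans hk) (blockIter_embIter ((hlv x).1.trans hk) (blockIter (lv x) x)) ν
    exact le_trans h (Nat.sub_le_sub_right (Nat.pow_le_pow_right P.L_pos (hlv x).1) 1)
  -- ★ THE BOND IDENTITY from the local closed word (the chain word runs along print bonds, §1)
  have hbond : ∀ b : PBond P 0, holAt U (walk (τ b.src) (cw b.src)) * U b * (holAt U (walk (τ b.tgt) (cw b.tgt)))⁻¹ = 1 := by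
    intro b
    obtain ⟨ω, hωend₀, hωhol₀, hωnd⟩ := exists_chainWord_of_shift_lam hk1 hk hnest hBU hsep hseg b.src b.dir (hlv b.src).1 (hlv b.tgt).1 (hlv b.src).2 (hlv b.tgt).2
    have hωend : walkEnd (τ b.src) ω = τ b.tgt := by rw [hτ, hτ]; exact hωend₀
    have hωhol : holAt U (walk (τ b.src) ω) = 1 := by rw [hτ]; exact hωhol₀
    have e2 : walkEnd b.tgt (wordRev (cw b.tgt)) = τ b.tgt := by
      have h := walkEnd_walkEnd_wordRev (τ b.tgt) (cw b.tgt); rwa [hcw_end] at h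
    have e3 : walkEnd (τ b.tgt) (wordRev ω) = τ b.src := by
      have h := walkEnd_walkEnd_wordRev (τ b.src) ω; rwa [hωend] at h
    have end2 : walkEnd (τ b.src) (cw b.src ++ [(b.dir, true)]) = b.tgt := by rw [walkEnd_append, hcw_end]; rfl
    have end3 : walkEnd (τ b.src) (cw b.src ++ [(b.dir, true)] ++ wordRev (cw b.tgt)) = τ b.tgt := by rw [walkEnd_append, end2, e2]
    have hclosed : walkEnd (τ b.src) (cw b.src ++ [(b.dir, true)] ++ wordRev (cw b.tgt) ++ wordRev ω) = τ b.src := by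
      rw [walkEnd_append, end3, e3]
    have hsmall : ∀ ν, (netDisp (cw b.src ++ [(b.dir, true)] ++ wordRev (cw b.tgt) ++ wordRev ω) ν).natAbs < P.sitesPerDir 0 := by
      intro ν
      rw [netDisp_append, netDisp_append, netDisp_append, netDisp_wordRev, netDisp_wordRev]
      have h1 := hcw_nd b.src ν
      have h2 := hcw_nd b.tgt ν
      have h3 := hωnd ν
      have h4 : (netDisp [((b.dir, true) : Letter P.d)] ν).natAbs ≤ 1 := natAbs_netDisp_le_length _ ν
      have hLk : 1 ≤ P.L ^ k := Nat.one_le_pow _ _ P.L_pos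
      have e : (P.d + 3) * P.L ^ k = (P.d + 1) * P.L ^ k + 2 * P.L ^ k := by ring
      rw [e] at hfit
      have t1 := Int.natAbs_add_le (netDisp (cw b.src) ν + netDisp [((b.dir, true) : Letter P.d)] ν + -netDisp (cw b.tgt) ν) (-netDisp ω ν)
      have t2 := Int.natAbs_add_le (netDisp (cw b.src) ν + netDisp [((b.dir, true) : Letter P.d)] ν) (-netDisp (cw b.tgt) ν)
      have t3 := Int.natAbs_add_le (netDisp (cw b.src) ν) (netDisp [((b.dir, true) : Letter P.d)] ν)
      rw [Int.natAbs_neg] at t1 t2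
      omega
    have hhol := hflat (τ b.src) _ (netDisp_eq_zero_of_walkEnd_eq hclosed hsmall)
    have p1 : holAt U (walk b.src [(b.dir, true)]) = U b := holAt_walk_single_true U b.src b.dir
    have p2 : holAt U (walk b.tgt (wordRev (cw b.tgt))) = (holAt U (walk (τ b.tgt) (cw b.tgt)))⁻¹ := by
      have h := holAt_walk_wordRev U (τ b.tgt) (cw b.tgt); rwa [hcw_end] at h
    have p3 : holAt U (walk (τ b.tgt) (wordRev ω)) = 1 := by
      have h := holAt_walk_wordRev U (τ b.src) ω
      rw [hωend, hωhol, inv_one] at h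
      exact h
    rw [holAt_walk_append U (τ b.src) (cw b.src ++ [(b.dir, true)] ++ wordRev (cw b.tgt)) (wordRev ω), end3, p3, mul_one,
      holAt_walk_append U (τ b.src) (cw b.src ++ [(b.dir, true)]) (wordRev (cw b.tgt)), end2, p2,
      holAt_walk_append U (τ b.src) (cw b.src) [(b.dir, true)], hcw_end, p1] at hhol
    exact hhol
  -- the comb gauge and `1^{u} = U`
  have hU : GaugeField.gaugeAct (fun x => (holAt U (walk (τ x) (cw x)))⁻¹) 1 = U := by
    funext b
    show (holAt U (walk (τ b.src) (cw b.src)))⁻¹ * 1 * ((holAt U (walk (τ b.tgt) (cw b.tgt)))⁻¹)⁻¹ = U b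
    rw [mul_one, inv_inv]
    exact (eq_inv_mul_of_mul_eq (mul_inv_eq_one.mp (hbond b))).symm
  refine ⟨fun x => (holAt U (walk (τ x) (cw x)))⁻¹, ?_, hU⟩
  -- (i) at the `Γ`-ends: the level of `ι_j s` is `j`, the comb is empty
  have hfix : ∀ {j : ℕ}, j ≤ k → ∀ {s : Site P j}, s ∈ genSet Ω k j → (holAt U (walk (τ (embIter j s)) (cw (embIter j s))))⁻¹ = 1 := by
    intro j hj s hs
    have hb : blockIter j (embIter j s) = s := blockIter_embIter (hj.trans hk) s
    have hsj : blockIter j (embIter j s) ∈ genSet Ω k j := by rw [hb]; exact hs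
    have e : lv (embIter j s) = j := level_unique_genSet hk hnest hBU (hlv _).1 hj (hlv _).2 hsj
    have hτs : τ (embIter j s) = embIter j s := by
      rw [hτ]
      revert e
      generalize lv (embIter j s) = n
      intro e
      subst e
      rw [hb]
    rw [hcw, hτs, ← hb]
    rw [holAt_comb_eq_one_of_eq U _ _ (by rw [hb]), inv_one]
  -- (ii) at BOTH ends of a PRINT bond, by (8) telescoped along its trivial segment of the pure gauge `U = 1^{u}`
  intro j hj c hc
  have hends : (holAt U (walk (τ (embIter j c.src)) (cw (embIter j c.src))))⁻¹ = (holAt U (walk (τ (embIter j c.tgt)) (cw (embIter j c.tgt))))⁻¹ := by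
    have h := hseg j hj c hc
    rw [← hU, holAt_gaugeAct_one_walk, ← embIter_shift_eq_walkEnd] at h
    exact (mul_inv_eq_one.mp h)
  show (holAt U (walk (τ (embIter j c.src)) (cw (embIter j c.src))))⁻¹ = 1 ∧ (holAt U (walk (τ (embIter j c.tgt)) (cw (embIter j c.tgt))))⁻¹ = 1
  rcases src_or_tgt_mem_genSet_of_mem_lamBondsSeq hc with hs | ht
  · exact ⟨hfix hj hs, by rw [← hends]; exact hfix hj hs⟩
  · exact ⟨by rw [hends]; exact hfix hj ht, hfix hj ht⟩

/-- ★★★ **THE TOWER-CENTRAL CLAUSE BETWEEN TWO FLAT FIBRE CONFIGURATIONS ON PRINT's BONDS.**  Under (N)(B)(S) and the letter budget: two holonomy-flat configurations with trivial straight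
transporters on the bonds of `lamBondsSeq Ω k` are related `U^u = U₀` by a gauge transformation whose tower restrictions `toMS u j` are EQUAL and CENTRAL (indeed `= 1`) at the two tower
sites of every print bond — the uniqueness clause of dag-n12-c's ✓p767125 `VariationalThm1EUSepTop7MGB … (lamDatum F) …` read at two flat minimisers.
[cite: Balaban1984PropagatorsII, (2.3) p.224; Balaban1985Variational, Thm 1 p.279, (3)–(4) p.278; Balaban1988Convergent, (2.2) p.255, (2.10)–(2.12) p.256; Balaban1989LargeFieldII, (1.25) p.362] -/
theorem exists_towerCentral_gauge_of_flat_segments_lamBondsSeq (hk1 : 1 ≤ k) (hk : k ≤ P.m + P.K)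
    (hnest : ∀ j, 1 ≤ j → j < k → Ω (j + 1) ⊆ Ω j) (hBU : ∀ j, 1 ≤ j → j ≤ k → IsBlockUnion j (Ω j))
    (hsep : ∀ j, 1 ≤ j → j + 1 ≤ k → ∀ (x z : Site P 0) (μ : Fin P.d), (z = x.shift μ ∨ x = z.shift μ) → z ∈ Ω (j + 1) →
      ∀ y : Site P 0, blockIter (j + 1) y = blockIter (j + 1) x → y ∈ Ω j)
    (hfit : (P.d + 3) * P.L ^ k ≤ P.sitesPerDir 0) (U U₀ : GaugeField P 0 G)
    (hflat : ∀ (x : Site P 0) (w : List (Letter P.d)), (∀ ν, netDisp w ν = 0) → holAt U (walk x w) = 1)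
    (hseg : ∀ j, j ≤ k → ∀ c ∈ lamBondsSeq Ω k j, holAt U (walk (embIter j c.src) (List.replicate (P.L ^ j) (c.dir, true))) = 1)
    (hflat₀ : ∀ (x : Site P 0) (w : List (Letter P.d)), (∀ ν, netDisp w ν = 0) → holAt U₀ (walk x w) = 1)
    (hseg₀ : ∀ j, j ≤ k → ∀ c ∈ lamBondsSeq Ω k j, holAt U₀ (walk (embIter j c.src) (List.replicate (P.L ^ j) (c.dir, true))) = 1) :
    ∃ u : GaugeTransf P 0 G, (∀ j, j ≤ k → ∀ b ∈ lamBondsSeq Ω k j,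
        toMS u j b.src = toMS u j b.tgt ∧ ∀ g : G, toMS u j b.src * g = g * toMS u j b.src) ∧ GaugeField.gaugeAct u U = U₀ := by
  obtain ⟨u₁, hu₁, hU⟩ := exists_gauge_eq_one_on_towers_of_flat_segments_lamBondsSeq hk1 hk hnest hBU hsep hfit U hflat hseg
  obtain ⟨u₀, hu₀, hU₀⟩ := exists_gauge_eq_one_on_towers_of_flat_segments_lamBondsSeq hk1 hk hnest hBU hsep hfit U₀ hflat₀ hseg₀
  refine ⟨fun x => u₀ x * (u₁ x)⁻¹, fun j hj b hb => ?_, ?_⟩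
  · obtain ⟨h1s, h1t⟩ := hu₁ j hj b hb
    obtain ⟨h0s, h0t⟩ := hu₀ j hj b hb
    show u₀ (embIter j b.src) * (u₁ (embIter j b.src))⁻¹ = u₀ (embIter j b.tgt) * (u₁ (embIter j b.tgt))⁻¹ ∧
      ∀ g : G, u₀ (embIter j b.src) * (u₁ (embIter j b.src))⁻¹ * g = g * (u₀ (embIter j b.src) * (u₁ (embIter j b.src))⁻¹)
    rw [h1s, h1t, h0s, h0t]
    exact ⟨rfl, fun g => by simp⟩
  · rw [← hU, gaugeAct_gaugeAct, ← hU₀]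
    congr 1
    funext x
    show u₀ x * (u₁ x)⁻¹ * u₁ x = u₀ x
    rw [inv_mul_cancel_right]

end Rigidity

end Summit.QuantumFields.YangMills.BalabanUVNodes.N12FlatDatumRigidityNestedLam
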